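import Summits.QuantumFields.YangMills.Theses.PoincareLipschitz
import Summits.QuantumFields.YangMills.Theorems.PoincareLipschitzStubBoundedBoxConcentration
import Literature.MathematicalPhysics.QuantumFieldTheory.Balaban1983to89.T4AxialGaugeSmallField
import HarnessLib

/-!
# LINE 30 «CurvaturePoincare» — typed SUB-PLAN for the hardest stub `stub_curvaturePinning` (NP): GEOMETRIC CORE + BOOKKEEPING

Not registered; a plan for whoever takes NP (ideator ym-r3-idea-2 g16).  NP splits as
* (NP-core, M–L, the new lemma) a LATTICE UHLENBECK / NONLINEAR POINCARÉ INEQUALITY ON A BOX: for every configuration `U` there is a gauge transformation `g`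
  with `Σ_{b ∈ box bonds} dist₁((U^g)_b)² ≤ (C·n)²·Σ_{p ∈ box plaquettes} dist₁(U(∂p))²` (absolute `C`; box = sites `s` with `(s_k − x₀_k).val < n`,
  non-wrapping since `2n ≤ sitesPerDir`).  Candidate `g`: the axial comb gauge ✓`T4AxialGaugeSmallField.axialGauge U lo hi` followed by the discrete
  Coulomb/Hodge correction on the box (minimise the bond sum over `g`); linear model: Poincaré for 1-forms modulo exact forms on the cubical box,
  `λ₁ ≥ c/n²`.
* (NP-book, S–M, pattern ✓p739571 `CombPeierlsStubAxialCombTransfer` (ii)) gauge invariance `f U = f (U^g)`, box-locality (replace `U^g` by `W := U^g` on box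
  bonds, `𝟙` elsewhere: ✓`mem_boxBonds_of_val_lt`), Lipschitz at `(W, 𝟙)`: `|f W − f 𝟙| ≤ Λ·(Σ_b dist₁(W_b·𝟙⁻¹)²)^{1/2} = Λ·(Σ_{box bonds} dist₁((U^g)_b)²)^{1/2}`.
Composition `curvaturePinning_of` is modus ponens.  `lean check` rc 0, sorries only in the two stubs.  Honesty: proves nothing; R3 = YM₃ on T³, NOT Clay.
-/

open scoped BigOperators
open MeasureTheory
open Literature.MathematicalPhysics.QuantumFieldTheory.Balaban1983to89
open Literature.MathematicalPhysics.QuantumFieldTheory.Balaban1983to89.T3ContinuumYM3Torus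
open Literature.MathematicalPhysics.QuantumFieldTheory.Balaban1983to89.T3UnitScaleTilt
open Literature.MathematicalPhysics.QuantumFieldTheory.Balaban1983to89.T3UnitLawDensityEML (ℰp)
open Literature.MathematicalPhysics.QuantumFieldTheory.Balaban1983to89.T4AxialGaugeSmallField (boxPlaqs castSite axialGauge)

namespace Summit.QuantumFields.YangMills.Cruxes.HistoryTailL.CurvaturePoincare.PlanNP

open Classical in
/-- (NP-core) the lattice Uhlenbeck lemma on a non-wrapping box: distance to pure gauge in `ℓ²(box bonds)` ≤ `C·n·‖curvature‖_{ℓ²(box plaquettes)}`. -/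
theorem stub_boxUhlenbeck :
    ∃ C : ℝ, 0 < C ∧ ∀ (F : T3Family) (K n : ℕ) (x₀ : Site (F.P K) 0), 1 ≤ n → 2 * n ≤ (F.P K).sitesPerDir 0 →
      ∀ U : GaugeField (F.P K) 0 (Matrix.specialUnitaryGroup (Fin 2) ℂ), ∃ g : GaugeTransf (F.P K) 0 (Matrix.specialUnitaryGroup (Fin 2) ℂ),
        (∑ b ∈ Finset.univ.filter (fun b : PBond (F.P K) 0 => (∀ k, (b.src k - x₀ k).val < n) ∧ (∀ k, (b.tgt k - x₀ k).val < n)), GaugeGroup.dist1 (GaugeField.gaugeAct g U b) ^ 2)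
          ≤ (C * (n : ℝ)) ^ 2 * (∑ p ∈ Finset.univ.filter (fun p : Plaq (F.P K) 0 => p ∈ boxPlaqs (P := F.P K) (j := 0) (fun k => ((x₀ k).val : ℤ)) (fun k => ((x₀ k).val : ℤ) + ((n : ℤ) - 1))), GaugeGroup.dist1 (GaugeField.plaqHol U p) ^ 2) := by
  sorry

open Classical in
/-- (NP-book) core ⟹ NP: gauge invariance + box-locality + the Lipschitz hypothesis at `(W, 𝟙)`. -/
theorem stub_pinning_of_boxUhlenbeck :
    (∃ C : ℝ, 0 < C ∧ ∀ (F : T3Family) (K n : ℕ) (x₀ : Site (F.P K) 0), 1 ≤ n → 2 * n ≤ (F.P K).sitesPerDir 0 →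
      ∀ U : GaugeField (F.P K) 0 (Matrix.specialUnitaryGroup (Fin 2) ℂ), ∃ g : GaugeTransf (F.P K) 0 (Matrix.specialUnitaryGroup (Fin 2) ℂ),
        (∑ b ∈ Finset.univ.filter (fun b : PBond (F.P K) 0 => (∀ k, (b.src k - x₀ k).val < n) ∧ (∀ k, (b.tgt k - x₀ k).val < n)), GaugeGroup.dist1 (GaugeField.gaugeAct g U b) ^ 2)
          ≤ (C * (n : ℝ)) ^ 2 * (∑ p ∈ Finset.univ.filter (fun p : Plaq (F.P K) 0 => p ∈ boxPlaqs (P := F.P K) (j := 0) (fun k => ((x₀ k).val : ℤ)) (fun k => ((x₀ k).val : ℤ) + ((n : ℤ) - 1))), GaugeGroup.dist1 (GaugeField.plaqHol U p) ^ 2)) →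
        ∃ C : ℝ, 0 < C ∧ ∀ (F : T3Family) (K n : ℕ) (x₀ : Site (F.P K) 0)
      (f : GaugeField (F.P K) 0 (Matrix.specialUnitaryGroup (Fin 2) ℂ) → ℝ) (Λ : ℝ), 0 ≤ Λ → 1 ≤ n → 2 * n ≤ (F.P K).sitesPerDir 0 →
      GaugeField.GaugeInvariant f →
      (∀ U U' : GaugeField (F.P K) 0 (Matrix.specialUnitaryGroup (Fin 2) ℂ),
        (∀ b : PBond (F.P K) 0, (∀ k, (b.src k - x₀ k).val < n) → (∀ k, (b.tgt k - x₀ k).val < n) → U b = U' b) → f U = f U') →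
      (∀ U U' : GaugeField (F.P K) 0 (Matrix.specialUnitaryGroup (Fin 2) ℂ),
        |f U - f U'| ≤ Λ * Real.sqrt (∑ b : PBond (F.P K) 0, GaugeGroup.dist1 (U b * (U' b)⁻¹) ^ 2)) →
      ∀ U : GaugeField (F.P K) 0 (Matrix.specialUnitaryGroup (Fin 2) ℂ),
        |f U - f (fun _ => 1)| ≤ Λ * (C * (n : ℝ)) * Real.sqrt (∑ p ∈ Finset.univ.filter (fun p : Plaq (F.P K) 0 => p ∈ boxPlaqs (P := F.P K) (j := 0) (fun k => ((x₀ k).val : ℤ)) (fun k => ((x₀ k).val : ℤ) + ((n : ℤ) - 1))), GaugeGroup.dist1 (GaugeField.plaqHol U p) ^ 2) := by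
  sorry

open Classical in
/-- NP from the two plan stubs. -/
theorem curvaturePinning_of :
        ∃ C : ℝ, 0 < C ∧ ∀ (F : T3Family) (K n : ℕ) (x₀ : Site (F.P K) 0)
      (f : GaugeField (F.P K) 0 (Matrix.specialUnitaryGroup (Fin 2) ℂ) → ℝ) (Λ : ℝ), 0 ≤ Λ → 1 ≤ n → 2 * n ≤ (F.P K).sitesPerDir 0 →
      GaugeField.GaugeInvariant f →
      (∀ U U' : GaugeField (F.P K) 0 (Matrix.specialUnitaryGroup (Fin 2) ℂ),
        (∀ b : PBond (F.P K) 0, (∀ k, (b.src k - x₀ k).val < n) → (∀ k, (b.tgt k - x₀ k).val < n) → U b = U' b) → f U = f U') →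
      (∀ U U' : GaugeField (F.P K) 0 (Matrix.specialUnitaryGroup (Fin 2) ℂ),
        |f U - f U'| ≤ Λ * Real.sqrt (∑ b : PBond (F.P K) 0, GaugeGroup.dist1 (U b * (U' b)⁻¹) ^ 2)) →
      ∀ U : GaugeField (F.P K) 0 (Matrix.specialUnitaryGroup (Fin 2) ℂ),
        |f U - f (fun _ => 1)| ≤ Λ * (C * (n : ℝ)) * Real.sqrt (∑ p ∈ Finset.univ.filter (fun p : Plaq (F.P K) 0 => p ∈ boxPlaqs (P := F.P K) (j := 0) (fun k => ((x₀ k).val : ℤ)) (fun k => ((x₀ k).val : ℤ) + ((n : ℤ) - 1))), GaugeGroup.dist1 (GaugeField.plaqHol U p) ^ 2) :=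
  stub_pinning_of_boxUhlenbeck stub_boxUhlenbeck

end Summit.QuantumFields.YangMills.Cruxes.HistoryTailL.CurvaturePoincare.PlanNP
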